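import Mathlib
import Literature.NumberTheory.Transcendental.SemialgebraicVolume
import Literature.NumberTheory.Transcendental.KZCalculusOver
import Summits.KontsevichZagierPeriods.KontsevichZagierPeriods.Theorems.DefinableMovesCircleSquaringImpossibleToolkit
import Summits.KontsevichZagierPeriods.KontsevichZagierPeriods.Theorems.DefinableMovesCircleSquaringImpossibleValid

/-!
# Volume preservation forces `λ = π`; a valid parameter is a genuine transport

Support file for item stmt-KontsevichZagierPeriods-5830 (`CircleSquaringImpossible`, route
DefinableMoves): the measure-theoretic half of the argument and the converse semantics of the
first-order transport condition `Valid` (file `…Valid`).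

* `vol (D × [0,1]^M) = π`, `vol ((0,λ) × (0,1) × [0,1]^M) = max(λ,0)` (Fubini through the measurable
  splitting `ℝ^(2+M) ≃ ℝ² × ℝ^M`; Mathlib's `EuclideanSpace.volume_ball_fin_two`).
* `eq_pi_of_transport` — if a measurable `s ⊆ D × [0,1]^M` of full measure is mapped by a map `Φ`,
  injective on `s` and differentiable within `s` with `|det Φ'| = 1`, onto a full-measure subset of
  `(0,λ) × (0,1) × [0,1]^M`, then `λ = π` (Mathlib's change-of-variables formula
  `lintegral_abs_det_fderiv_eq_addHaar_image`); no semialgebraicity involved.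
* `volume_eq_zero_of_interior_eq_empty` — an `ℝ`-semialgebraic set with empty interior is null
  (tree `volume_frontier_eq_zero_of_isSemialgebraic`).
* `eq_pi_of_valid` — if `G` is a `ℚ`-semialgebraic family and `Valid(λ, c)` holds at a real
  parameter `c`, the fibre `G_c` is the graph of a genuine transport (an `ℝ`-semialgebraic, hence
  measurable, domain of full measure in the disc-cylinder, a map injective on it, differentiable
  within it with unimodular Jacobian, onto a full-measure subset of the box-cylinder of length
  `λ`), so `λ = π`.

All folklore.
-/

noncomputable section

open Set MeasureTheory Filter Topology MvPolynomial

namespace Summit.KontsevichZagierPeriods.DefinableMoves.CircleSquaring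

open Literature.ModelTheory.ExponentialFields

/-! ### Volumes -/

/-- **The measurable splitting `ℝ^(2+M) ≃ ℝ² × ℝ^M`**, `z ↦ ((z₀, z₁), (z₂, …))`, preserves
Lebesgue measure (Mathlib: `volume_measurePreserving_piCongrLeft`,
`volume_measurePreserving_sumPiEquivProdPi`). [folklore] -/
theorem exists_split (M : ℕ) :
    ∃ e : (Fin (2 + M) → ℝ) ≃ᵐ (Fin 2 → ℝ) × (Fin M → ℝ),
      MeasurePreserving e (volume : Measure (Fin (2 + M) → ℝ))
          (volume : Measure ((Fin 2 → ℝ) × (Fin M → ℝ))) ∧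
        ∀ z, e z = (fun i => z (Fin.castAdd M i), fun j => z (Fin.natAdd 2 j)) :=
  ⟨(MeasurableEquiv.piCongrLeft (fun _ : Fin (2 + M) => ℝ) finSumFinEquiv).symm.trans
      (MeasurableEquiv.sumPiEquivProdPi fun _ : Fin 2 ⊕ Fin M => ℝ),
    (volume_measurePreserving_sumPiEquivProdPi fun _ : Fin 2 ⊕ Fin M => ℝ).comp
      (MeasurePreserving.symm _
        (volume_measurePreserving_piCongrLeft (fun _ : Fin (2 + M) => ℝ)
          (finSumFinEquiv (m := 2) (n := M)))),
    fun _ => rfl⟩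

/-- Area of the unit disc `{w : Fin 2 → ℝ | w 0 ² + w 1 ² < 1}` is `π` (through Mathlib's
`EuclideanSpace.volume_ball_fin_two`). [folklore] -/
theorem volume_unitDisc :
    volume {w : Fin 2 → ℝ | w 0 ^ 2 + w 1 ^ 2 < 1} = ENNReal.ofReal Real.pi := by
  have hmp := PiLp.volume_preserving_toLp (Fin 2)
  have hset : {w : Fin 2 → ℝ | w 0 ^ 2 + w 1 ^ 2 < 1} =
      (WithLp.toLp 2) ⁻¹' Metric.ball (0 : EuclideanSpace ℝ (Fin 2)) 1 := by
    ext w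
    simp [EuclideanSpace.ball_zero_eq 1 zero_le_one, Fin.sum_univ_two]
  rw [hset, hmp.measure_preimage measurableSet_ball.nullMeasurableSet,
    EuclideanSpace.volume_ball_fin_two, ENNReal.ofReal_one, one_pow, one_mul]

/-- The unit cube `{y | ∀ j, y j ∈ [0,1]} ⊆ ℝ^M` has volume `1`. [folklore] -/
theorem volume_unitCube (M : ℕ) :
    volume {y : Fin M → ℝ | ∀ j, y j ∈ Set.Icc (0:ℝ) 1} = 1 := by
  have hset : {y : Fin M → ℝ | ∀ j, y j ∈ Set.Icc (0:ℝ) 1} = Set.Icc (0 : Fin M → ℝ) 1 := by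
    ext y
    simp only [mem_setOf_eq, mem_Icc, Pi.le_def, Pi.zero_apply, Pi.one_apply]
    exact ⟨fun h => ⟨fun j => (h j).1, fun j => (h j).2⟩, fun h j => ⟨h.1 j, h.2 j⟩⟩
  rw [hset, Real.volume_Icc_pi]
  simp

/-- `volume (D × [0,1]^M) = π`. [folklore] -/
theorem volume_discCyl (M : ℕ) : volume {z : Fin (2 + M) → ℝ | z (Fin.castAdd M 0) ^ 2 + z (Fin.castAdd M 1) ^ 2 < 1 ∧
      ∀ j : Fin M, z (Fin.natAdd 2 j) ∈ Set.Icc (0:ℝ) 1} = ENNReal.ofReal Real.pi := by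
  obtain ⟨e, he, he_apply⟩ := exists_split M
  have hset : {z : Fin (2 + M) → ℝ | z (Fin.castAdd M 0) ^ 2 + z (Fin.castAdd M 1) ^ 2 < 1 ∧
        ∀ j : Fin M, z (Fin.natAdd 2 j) ∈ Set.Icc (0:ℝ) 1} = e ⁻¹'
      ({w : Fin 2 → ℝ | w 0 ^ 2 + w 1 ^ 2 < 1} ×ˢ {y : Fin M → ℝ | ∀ j, y j ∈ Set.Icc (0:ℝ) 1}) := by
    ext z
    simp only [he_apply, mem_setOf_eq, mem_preimage, mem_prod]
  have hmeas : MeasurableSet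
      ({w : Fin 2 → ℝ | w 0 ^ 2 + w 1 ^ 2 < 1} ×ˢ {y : Fin M → ℝ | ∀ j, y j ∈ Set.Icc (0:ℝ) 1}) := by
    refine MeasurableSet.prod ?_ ?_
    · exact measurableSet_lt (by fun_prop) measurable_const
    · have : {y : Fin M → ℝ | ∀ j, y j ∈ Set.Icc (0:ℝ) 1} = ⋂ j, (fun y : Fin M → ℝ => y j) ⁻¹' Icc 0 1 := by
        ext y; simp
      rw [this]
      exact MeasurableSet.iInter fun j => measurableSet_Icc.preimage (measurable_pi_apply j)
  rw [hset, he.measure_preimage hmeas.nullMeasurableSet,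
    Measure.volume_eq_prod, Measure.prod_prod, volume_unitDisc, volume_unitCube, mul_one]

/-- `volume ((0,λ) × (0,1) × [0,1]^M) = max(λ, 0)` (as `ENNReal.ofReal λ`). [folklore] -/
theorem volume_boxCyl (M : ℕ) (l : ℝ) : volume {z : Fin (2 + M) → ℝ | z (Fin.castAdd M 0) ∈ Set.Ioo 0 l ∧ z (Fin.castAdd M 1) ∈ Set.Ioo (0:ℝ) 1 ∧
      ∀ j : Fin M, z (Fin.natAdd 2 j) ∈ Set.Icc (0:ℝ) 1} = ENNReal.ofReal l := by
  obtain ⟨e, he, he_apply⟩ := exists_split M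
  have hset : {z : Fin (2 + M) → ℝ | z (Fin.castAdd M 0) ∈ Set.Ioo 0 l ∧ z (Fin.castAdd M 1) ∈ Set.Ioo (0:ℝ) 1 ∧
        ∀ j : Fin M, z (Fin.natAdd 2 j) ∈ Set.Icc (0:ℝ) 1} = e ⁻¹'
      ((Set.pi univ fun i => Ioo ((0 : Fin 2 → ℝ) i) (![l, 1] i)) ×ˢ
        {y : Fin M → ℝ | ∀ j, y j ∈ Set.Icc (0:ℝ) 1}) := by
    ext z
    simp only [he_apply, mem_setOf_eq, mem_preimage, mem_prod, Set.mem_pi, mem_univ,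
      true_implies, Fin.forall_fin_two, Pi.zero_apply, Matrix.cons_val_zero, Matrix.cons_val_one]
    simp only [and_assoc]
  have hmeas : MeasurableSet
      ((Set.pi univ fun i => Ioo ((0 : Fin 2 → ℝ) i) (![l, 1] i)) ×ˢ
        {y : Fin M → ℝ | ∀ j, y j ∈ Set.Icc (0:ℝ) 1}) := by
    refine MeasurableSet.prod (MeasurableSet.univ_pi fun i => measurableSet_Ioo) ?_
    have : {y : Fin M → ℝ | ∀ j, y j ∈ Set.Icc (0:ℝ) 1} = ⋂ j, (fun y : Fin M → ℝ => y j) ⁻¹' Icc 0 1 := by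
      ext y; simp
    rw [this]
    exact MeasurableSet.iInter fun j => measurableSet_Icc.preimage (measurable_pi_apply j)
  rw [hset, he.measure_preimage hmeas.nullMeasurableSet,
    Measure.volume_eq_prod, Measure.prod_prod, Real.volume_pi_Ioo, volume_unitCube, mul_one,
    Fin.prod_univ_two]
  simp

/-- **Volume preservation forces `λ = π`.** If a measurable `s ⊆ D × [0,1]^M` of full measure is
mapped by `Φ` — injective on `s`, differentiable within `s` with `|det Φ'| = 1` on `s` — onto a
full-measure subset of `(0,λ) × (0,1) × [0,1]^M`, then `λ = π`: by the change-of-variables formula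
`vol (Φ '' s) = ∫_s |det Φ'| = vol s`, so `max(λ,0) = π`. [folklore] -/
theorem eq_pi_of_transport {M : ℕ} {l : ℝ} {s : Set (Fin (2 + M) → ℝ)}
    {Φ : (Fin (2 + M) → ℝ) → (Fin (2 + M) → ℝ)}
    {Φ' : (Fin (2 + M) → ℝ) → (Fin (2 + M) → ℝ) →L[ℝ] (Fin (2 + M) → ℝ)}
    (hs : MeasurableSet s) (h1 : s ⊆ {z : Fin (2 + M) → ℝ | z (Fin.castAdd M 0) ^ 2 + z (Fin.castAdd M 1) ^ 2 < 1 ∧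
          ∀ j : Fin M, z (Fin.natAdd 2 j) ∈ Set.Icc (0:ℝ) 1}) (h2 : volume ({z : Fin (2 + M) → ℝ | z (Fin.castAdd M 0) ^ 2 + z (Fin.castAdd M 1) ^ 2 < 1 ∧
                ∀ j : Fin M, z (Fin.natAdd 2 j) ∈ Set.Icc (0:ℝ) 1} \ s) = 0)
    (h3 : Φ '' s ⊆ {z : Fin (2 + M) → ℝ | z (Fin.castAdd M 0) ∈ Set.Ioo 0 l ∧ z (Fin.castAdd M 1) ∈ Set.Ioo (0:ℝ) 1 ∧
          ∀ j : Fin M, z (Fin.natAdd 2 j) ∈ Set.Icc (0:ℝ) 1}) (h4 : volume ({z : Fin (2 + M) → ℝ | z (Fin.castAdd M 0) ∈ Set.Ioo 0 l ∧ z (Fin.castAdd M 1) ∈ Set.Ioo (0:ℝ) 1 ∧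
                ∀ j : Fin M, z (Fin.natAdd 2 j) ∈ Set.Icc (0:ℝ) 1} \ Φ '' s) = 0)
    (h7 : Set.InjOn Φ s) (h8 : ∀ x ∈ s, HasFDerivWithinAt Φ (Φ' x) s x)
    (h9 : ∀ x ∈ s, |(Φ' x).det| = 1) :
    l = Real.pi := by
  have himg : volume (Φ '' s) = volume s := by
    rw [← lintegral_abs_det_fderiv_eq_addHaar_image volume hs h8 h7]
    rw [setLIntegral_congr_fun hs (g := fun _ => 1) fun x hx => by
      simp only [h9 x hx, ENNReal.ofReal_one]]
    exact setLIntegral_one s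
  have hvs : volume s = volume {z : Fin (2 + M) → ℝ | z (Fin.castAdd M 0) ^ 2 + z (Fin.castAdd M 1) ^ 2 < 1 ∧
        ∀ j : Fin M, z (Fin.natAdd 2 j) ∈ Set.Icc (0:ℝ) 1} := measure_eq_measure_of_null_sdiff h1 h2
  have hvi : volume (Φ '' s) = volume {z : Fin (2 + M) → ℝ | z (Fin.castAdd M 0) ∈ Set.Ioo 0 l ∧ z (Fin.castAdd M 1) ∈ Set.Ioo (0:ℝ) 1 ∧
        ∀ j : Fin M, z (Fin.natAdd 2 j) ∈ Set.Icc (0:ℝ) 1} := measure_eq_measure_of_null_sdiff h3 h4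
  rw [volume_discCyl] at hvs
  rw [volume_boxCyl] at hvi
  have h : ENNReal.ofReal l = ENNReal.ofReal Real.pi := by rw [← hvi, himg, hvs]
  have hl : 0 < l := by
    by_contra hle
    rw [ENNReal.ofReal_of_nonpos (le_of_not_gt hle)] at h
    exact absurd h.symm (ne_of_gt (ENNReal.ofReal_pos.2 Real.pi_pos))
  exact (ENNReal.ofReal_eq_ofReal_iff hl.le Real.pi_pos.le).1 h

/-! ### Empty interior ⟹ null, for real semialgebraic sets -/

/-- An `ℝ`-semialgebraic subset of `ℝⁿ` with empty interior is Lebesgue-null: it lies in its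
closure, which is then its frontier, a null set (tree
`volume_frontier_eq_zero_of_isSemialgebraic`). [folklore] -/
theorem volume_eq_zero_of_interior_eq_empty {n : ℕ} {A : Set (Fin n → ℝ)}
    (hA : Literature.ModelTheory.ExponentialFields.IsSemialgebraic ℝ A) (h : interior A = ∅) :
    volume A = 0 := by
  have hfr := Literature.NumberTheory.Transcendental.volume_frontier_eq_zero_of_isSemialgebraic hA
  refine measure_mono_null ?_ hfr
  intro x hx
  rw [frontier, h, sdiff_empty]
  exact subset_closure hx

/-! ### Real semialgebraicity of the fibre objects -/

/-- The fibre `{t | (c, t) ∈ G}` of a `ℚ`-semialgebraic family at a REAL parameter `c` is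
`ℝ`-semialgebraic (pull back the base change of `G` along the `ℝ`-polynomial map `t ↦ (c, t)`).
[folklore] -/
theorem isSemialgebraic_real_fibre {γ ι : Type} {G : Set (γ ⊕ ι → ℝ)} (hG : IsSemialgebraic ℚ G)
    (c : γ → ℝ) : IsSemialgebraic ℝ {t : ι → ℝ | Sum.elim c t ∈ G} := by
  have hG' : IsSemialgebraic ℝ G := hG.baseChange ℝ
  have h := hG'.preimage_aeval
    (Sum.elim (fun g => C (c g)) (fun i => X i) : γ ⊕ ι → MvPolynomial ι ℝ)
  convert h using 1
  ext t
  simp only [mem_setOf_eq, mem_preimage]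
  congr! 1
  funext j
  rcases j with g | i <;> simp

/-- The disc-cylinder is `ℝ`-semialgebraic. [folklore] -/
theorem isSemialgebraic_discCyl (M : ℕ) : IsSemialgebraic ℝ {z : Fin (2 + M) → ℝ | z (Fin.castAdd M 0) ^ 2 + z (Fin.castAdd M 1) ^ 2 < 1 ∧
      ∀ j : Fin M, z (Fin.natAdd 2 j) ∈ Set.Icc (0:ℝ) 1} := by
  have h1 : IsSemialgebraic ℝ {z : Fin (2 + M) → ℝ |
      z (Fin.castAdd M 0) ^ 2 + z (Fin.castAdd M 1) ^ 2 < 1} :=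
    isSemialgebraic_setOf_lt (X (Fin.castAdd M 0) ^ 2 + X (Fin.castAdd M 1) ^ 2) 1
      (fun v => by simp) (fun v => by simp)
  have h2 : IsSemialgebraic ℝ {z : Fin (2 + M) → ℝ |
      ∀ j : Fin M, z (Fin.natAdd 2 j) ∈ Set.Icc (0:ℝ) 1} := by
    refine IsSemialgebraic.forall_index fun j => ?_
    exact IsSemialgebraic.and
      (isSemialgebraic_setOf_le (k := ℝ) 0 (X (Fin.natAdd 2 j)) (fun v => by simp) (fun v => by simp))
      (isSemialgebraic_setOf_le (k := ℝ) (X (Fin.natAdd 2 j)) 1 (fun v => by simp) (fun v => by simp))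
  exact h1.inter h2

/-- The box-cylinder of length `l` is `ℝ`-semialgebraic. [folklore] -/
theorem isSemialgebraic_boxCyl (M : ℕ) (l : ℝ) : IsSemialgebraic ℝ {z : Fin (2 + M) → ℝ | z (Fin.castAdd M 0) ∈ Set.Ioo 0 l ∧ z (Fin.castAdd M 1) ∈ Set.Ioo (0:ℝ) 1 ∧
      ∀ j : Fin M, z (Fin.natAdd 2 j) ∈ Set.Icc (0:ℝ) 1} := by
  have h1 : IsSemialgebraic ℝ {z : Fin (2 + M) → ℝ | z (Fin.castAdd M 0) ∈ Set.Ioo 0 l} :=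
    IsSemialgebraic.and
      (isSemialgebraic_setOf_lt (k := ℝ) 0 (X (Fin.castAdd M 0)) (fun v => by simp) (fun v => by simp))
      (isSemialgebraic_setOf_lt (k := ℝ) (X (Fin.castAdd M 0)) (C l) (fun v => by simp) (fun v => by simp))
  have h2 : IsSemialgebraic ℝ {z : Fin (2 + M) → ℝ | z (Fin.castAdd M 1) ∈ Set.Ioo (0:ℝ) 1} :=
    IsSemialgebraic.and
      (isSemialgebraic_setOf_lt (k := ℝ) 0 (X (Fin.castAdd M 1)) (fun v => by simp) (fun v => by simp))
      (isSemialgebraic_setOf_lt (k := ℝ) (X (Fin.castAdd M 1)) 1 (fun v => by simp) (fun v => by simp))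
  have h3 : IsSemialgebraic ℝ {z : Fin (2 + M) → ℝ |
      ∀ j : Fin M, z (Fin.natAdd 2 j) ∈ Set.Icc (0:ℝ) 1} := by
    refine IsSemialgebraic.forall_index fun j => ?_
    exact IsSemialgebraic.and
      (isSemialgebraic_setOf_le (k := ℝ) 0 (X (Fin.natAdd 2 j)) (fun v => by simp) (fun v => by simp))
      (isSemialgebraic_setOf_le (k := ℝ) (X (Fin.natAdd 2 j)) 1 (fun v => by simp) (fun v => by simp))
  exact h1.inter (h2.inter h3)

/-! ### A valid parameter is a genuine transport -/

/-- **A valid parameter forces `λ = π`.** For a `ℚ`-semialgebraic family `G` and a real parameter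
`c` with `Valid(λ, c)`, the fibre `G_c` is the graph of a volume-preserving a.e.-transport from
the disc-cylinder onto the box-cylinder of length `λ`; hence `λ = π`. [folklore] -/
theorem eq_pi_of_valid {γ : Type} [Fintype γ] {M : ℕ}
    {G : Set (γ ⊕ (Fin (2 + M) ⊕ Fin (2 + M)) → ℝ)} (hG : IsSemialgebraic ℚ G)
    {l : ℝ} {c : γ → ℝ} (hV : ((∀ x y y' : Fin (2 + M) → ℝ, Sum.elim c (Sum.elim x y) ∈ G → Sum.elim c (Sum.elim x y') ∈ G →
          ∀ i, y i = y' i)) ∧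
          ((∀ x y : Fin (2 + M) → ℝ, Sum.elim c (Sum.elim x y) ∈ G → x ∈ {z : Fin (2 + M) → ℝ | z (Fin.castAdd M 0) ^ 2 + z (Fin.castAdd M 1) ^ 2 < 1 ∧
                ∀ j : Fin M, z (Fin.natAdd 2 j) ∈ Set.Icc (0:ℝ) 1})) ∧
          ((∀ x : Fin (2 + M) → ℝ, ∀ r : Fin 1 → ℝ, 0 < r 0 →
                ∃ x' : Fin (2 + M) → ℝ, (∀ i, (x' i - x i) ^ 2 < r 0) ∧
                  (x' ∈ {z : Fin (2 + M) → ℝ | z (Fin.castAdd M 0) ^ 2 + z (Fin.castAdd M 1) ^ 2 < 1 ∧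
                        ∀ j : Fin M, z (Fin.natAdd 2 j) ∈ Set.Icc (0:ℝ) 1} → ∃ y : Fin (2 + M) → ℝ, Sum.elim c (Sum.elim x' y) ∈ G))) ∧
          ((∀ x y : Fin (2 + M) → ℝ, Sum.elim c (Sum.elim x y) ∈ G → y ∈ {z : Fin (2 + M) → ℝ | z (Fin.castAdd M 0) ∈ Set.Ioo 0 l ∧ z (Fin.castAdd M 1) ∈ Set.Ioo (0:ℝ) 1 ∧
                ∀ j : Fin M, z (Fin.natAdd 2 j) ∈ Set.Icc (0:ℝ) 1})) ∧
          ((∀ y : Fin (2 + M) → ℝ, ∀ r : Fin 1 → ℝ, 0 < r 0 →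
                ∃ y' : Fin (2 + M) → ℝ, (∀ i, (y' i - y i) ^ 2 < r 0) ∧
                  (y' ∈ {z : Fin (2 + M) → ℝ | z (Fin.castAdd M 0) ∈ Set.Ioo 0 l ∧ z (Fin.castAdd M 1) ∈ Set.Ioo (0:ℝ) 1 ∧
                        ∀ j : Fin M, z (Fin.natAdd 2 j) ∈ Set.Icc (0:ℝ) 1} → ∃ x : Fin (2 + M) → ℝ, Sum.elim c (Sum.elim x y') ∈ G))) ∧
          ((∀ x x' y : Fin (2 + M) → ℝ, Sum.elim c (Sum.elim x y) ∈ G → Sum.elim c (Sum.elim x' y) ∈ G →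
                ∀ i, x i = x' i)) ∧
          ((∀ x y₀ : Fin (2 + M) → ℝ, Sum.elim c (Sum.elim x y₀) ∈ G →
                ∃ L : Fin (2 + M) × Fin (2 + M) → ℝ, (Matrix.of fun i j => L (i, j)).det ^ 2 = 1 ∧
                  ∀ e : Fin 1 → ℝ, 0 < e 0 → ∃ d : Fin 1 → ℝ, 0 < d 0 ∧
                    ∀ x' y : Fin (2 + M) → ℝ, Sum.elim c (Sum.elim x' y) ∈ G →
                      (∀ i, (x' i - x i) ^ 2 < d 0) →
                        ∀ i, ∃ j, (y i - y₀ i - ∑ k, L (i, k) * (x' k - x k)) ^ 2 ≤ e 0 * (x' j - x j) ^ 2))) : l = Real.pi := by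
  classical
  obtain ⟨h1, h2, h3, h4, h5, h6, h7⟩ := hV
  have hn : 0 < 2 + M := by omega
  -- the fibre and its projections are `ℝ`-semialgebraic
  have hGc : IsSemialgebraic ℝ {t : Fin (2 + M) ⊕ Fin (2 + M) → ℝ | Sum.elim c t ∈ G} :=
    isSemialgebraic_real_fibre hG c
  set dom : Set (Fin (2 + M) → ℝ) := {x | ∃ y, Sum.elim c (Sum.elim x y) ∈ G} with hdom
  set im : Set (Fin (2 + M) → ℝ) := {y | ∃ x, Sum.elim c (Sum.elim x y) ∈ G} with him
  have hdomSA : IsSemialgebraic ℝ dom := hGc.exists_sum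
  have himSA : IsSemialgebraic ℝ im := hGc.exists_sum_left
  -- the map
  set Φ : (Fin (2 + M) → ℝ) → (Fin (2 + M) → ℝ) :=
    fun x => if h : ∃ y, Sum.elim c (Sum.elim x y) ∈ G then h.choose else 0 with hΦdef
  have hΦ : ∀ x, x ∈ dom → Sum.elim c (Sum.elim x (Φ x)) ∈ G := by
    intro x hx
    have hx' : ∃ y, Sum.elim c (Sum.elim x y) ∈ G := hx
    simp only [hΦdef, dif_pos hx']
    exact hx'.choose_spec
  have hrel : ∀ x y, Sum.elim c (Sum.elim x y) ∈ G ↔ x ∈ dom ∧ y = Φ x := by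
    intro x y
    constructor
    · intro h
      have hx : x ∈ dom := ⟨y, h⟩
      exact ⟨hx, funext fun i => h1 x y (Φ x) h (hΦ x hx) i⟩
    · rintro ⟨hx, rfl⟩
      exact hΦ x hx
  have himage : Φ '' dom = im := by
    ext y
    simp only [mem_image, him, mem_setOf_eq]
    constructor
    · rintro ⟨x, hx, rfl⟩
      exact ⟨x, hΦ x hx⟩
    · rintro ⟨x, hx⟩
      rw [hrel] at hx
      exact ⟨x, hx.1, hx.2.symm⟩
  -- the derivative
  have hL : ∀ x, x ∈ dom → ∃ L : Fin (2 + M) × Fin (2 + M) → ℝ,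
      (Matrix.of fun i j => L (i, j)).det ^ 2 = 1 ∧
      HasFDerivWithinAt Φ (LinearMap.toContinuousLinearMap
        (Matrix.toLin' (Matrix.of fun i j => L (i, j)))) dom x := by
    intro x hx
    obtain ⟨L, hdet, hP⟩ := h7 x (Φ x) (hΦ x hx)
    refine ⟨L, hdet, (hasFDerivWithinAt_iff_sq hn).2 fun e he => ?_⟩
    obtain ⟨d, hd, hQ⟩ := hP (fun _ => e) he
    refine ⟨d 0, hd, fun x' hx' hcube i => ?_⟩
    obtain ⟨j, hj⟩ := hQ x' (Φ x') (hΦ x' hx') hcube i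
    refine ⟨j, ?_⟩
    have happ : (LinearMap.toContinuousLinearMap
        (Matrix.toLin' (Matrix.of fun i j => L (i, j)))) (x' - x) i =
        ∑ k, L (i, k) * (x' k - x k) := by
      simp [Matrix.toLin'_apply, Matrix.mulVec, dotProduct]
    rw [happ]
    exact hj
  choose! Lf hLdet hLderiv using hL
  -- assemble
  refine eq_pi_of_transport (s := dom) (Φ := Φ)
    (Φ' := fun x => LinearMap.toContinuousLinearMap
      (Matrix.toLin' (Matrix.of fun i j => Lf x (i, j))))
    (IsSemialgebraic.measurableSet_holds hdomSA) ?_ ?_ ?_ ?_ ?_ (fun x hx => hLderiv x hx) ?_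
  · -- dom ⊆ discCyl
    intro x hx
    exact h2 x (Φ x) (hΦ x hx)
  · -- the complement of dom in the disc-cylinder is null
    refine volume_eq_zero_of_interior_eq_empty ((isSemialgebraic_discCyl M).diff hdomSA)
      (interior_eq_empty_of_cube fun x r hr => ?_)
    obtain ⟨x', hc, himp⟩ := h3 x (fun _ => r) hr
    exact ⟨x', hc, fun hx' => hx'.2 (himp hx'.1)⟩
  · -- image ⊆ boxCyl
    rintro _ ⟨x, hx, rfl⟩
    exact h4 x (Φ x) (hΦ x hx)
  · -- the complement of the image in the box-cylinder is null
    rw [himage]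
    refine volume_eq_zero_of_interior_eq_empty ((isSemialgebraic_boxCyl M l).diff himSA)
      (interior_eq_empty_of_cube fun y r hr => ?_)
    obtain ⟨y', hc, himp⟩ := h5 y (fun _ => r) hr
    exact ⟨y', hc, fun hy' => hy'.2 (himp hy'.1)⟩
  · -- injectivity
    intro x₁ hx₁ x₂ hx₂ heq
    have r₁ := hΦ x₁ hx₁
    have r₂ := hΦ x₂ hx₂
    rw [← heq] at r₂
    exact funext fun i => h6 x₁ x₂ (Φ x₁) r₁ r₂ i
  · -- unimodularity
    intro x hx
    have hdet : (LinearMap.toContinuousLinearMap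
        (Matrix.toLin' (Matrix.of fun i j => Lf x (i, j)))).det =
        (Matrix.of fun i j => Lf x (i, j)).det := by
      simp [ContinuousLinearMap.det, LinearMap.det_toLin']
    rw [hdet]
    have hsq : |(Matrix.of fun i j => Lf x (i, j)).det| ^ 2 = 1 ^ 2 := by
      rw [sq_abs, one_pow]
      exact hLdet x hx
    exact (pow_left_inj₀ (abs_nonneg _) zero_le_one two_ne_zero).1 hsq

end Summit.KontsevichZagierPeriods.DefinableMoves.CircleSquaring
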